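import Summits.QuantumFields.YangMills.Theorems.AllWindowsColdBoxBoxHighLineDirichletSlabPoincare
import Summits.QuantumFields.YangMills.Theorems.AllWindowsColdBoxBoxKernelGreen

/-!
# The J′-engine box Laplacian `BoxKernel.boxLap M univ` IS the Dirichlet Laplacian matrix of its point set: ℓ² floors for `boxLap (2H) univ`,
# its inverse, `boxLap (2H) univ ⊗ₖ 1₃` and its row/column-small perturbations — the hypothesis shape of (4g) for `fpOperator H U`
# (STUB-PLAN-S5U5-STEP1b §2 (4f)/(4g); LINE-19 S5 ⟨stmt-QuantumFields-24004⟩/⟨24335⟩, LINE-20 U5 ⟨24336⟩; part 3 of 3)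

Width seat `ym-line-sfw-p2-w4` (prover-ym-line-sfw-p2-w4-g27-0).  Planner `ym-idea-2` (17:04:37Z) asked that `fpOperator H 1` of brick (4c) be LITERALLY
`boxLap (2*H) Finset.univ ⊗ 1₃` (`…BoxKernelGreen`: `Box 4 (2H) univ` = coordinates in `[1, 2H−1]⁴` = `interiorSites H`).  This file puts part 2's floor in
that currency:
* **`boxLap_univ_apply_eq_dirichletMatrix`** — with all faces Dirichlet (`upCoeff = downCoeff = 1`), `boxLap M univ s t` equals, under `coords`, the entry of
  the Literature matrix `dirichletMatrix (univ.image coords)` (`2d` on the diagonal, `−1` on lattice neighbours, `0` otherwise); `coordsEquiv_bijective`;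
* **`boxLap_univ_poincare`** (`‖f‖² ≤ (M−1)²·fᵀ(boxLap M univ)f`, any `d ≥ 1`, by reindexing part 2 along `coords`) and `boxLap_univ_opFloor`
  (`‖f‖² ≤ (M−1)⁴‖boxLap M univ f‖²`);
* the cold box `M = 2H`, `H ≥ 1`: `boxLap_twoMul_floor` (`(1/4)/H²·‖f‖² ≤ fᵀLf`), **`boxLap_twoMul_opFloor`** (`(1/16)/H⁴·‖f‖² ≤ ‖Lf‖²`),
  `isUnit_det_boxLap_twoMul`, `boxLap_twoMul_inv_opBound` (`‖L⁻¹w‖² ≤ 16H⁴‖w‖²`, i.e. `‖(boxLap (2H) univ)⁻¹‖₂ ≤ 4H²`), `boxLap_twoMul_inv_form_le`;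
* **`inv_add_pointwise_le`** — `(1 − a r)²·‖(A + E)⁻¹w‖² ≤ ‖A⁻¹w‖²` pointwise from `‖A⁻¹‖₂ ≤ a`, `‖E‖₂ ≤ r`, `a r < 1` (so Frobenius norms, i.e. the
  `tr((MᵀM)⁻¹) = ‖M⁻¹‖_F²` of the 4i Haar–Gaussian merge, perturb with the factor `(1 − a r)⁻²`; `sum_sq_eq_sum_mulVec_single`), and its cold-box instance
  `boxLap_twoMul_kronecker_add_inv_pointwise` (`a = 4H²`, row/column-ℓ¹(E) ≤ r, `4H²r < 1`);
* `opFloor_submatrix_equiv` — the operator floor passes along a reindexing `e : κ ≃ ι` (the (4g) brick lives on `Fin n`);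
* the colour-diagonal operator and its perturbations: `boxLap_twoMul_kronecker_opFloor` (`(1/16)/H⁴·‖w‖² ≤ ‖(L ⊗ₖ 1)w‖²`),
  **`boxLap_twoMul_kronecker_add_opFloor`** — for any `E` with row and column ℓ¹ sums `≤ r ≤ (1/4)/H²`:
  `((1/4)/H² − r)²·‖w‖² ≤ ‖(boxLap (2H) univ ⊗ₖ 1 + E)w‖²` (= the hypothesis `λ·(v ⬝ᵥ v) ≤ Mv ⬝ᵥ Mv` of (4g) `GaussianTailBound` for
  `M = fpOperator H U` once (4c) exhibits `fpOperator H U = boxLap (2H) univ ⊗ₖ 1₃ + E(U)` with `‖E(U)‖_{row,col ℓ¹} ≤ C r₀ ≤ (1/8)/H²`, which is the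
  regime `r₀H² → 0` of STEP1b §4), and **`boxLap_twoMul_kronecker_add_inv`** — then `boxLap ⊗ 1 + E` is invertible with
  `‖(boxLap ⊗ 1 + E)⁻¹u‖² ≤ ((1/4)/H² − r)⁻²‖u‖²` (the `‖(fpOperator H U)⁻¹‖₂ ≤ C H²` clause of STEP1b §2 (4f)).

Everything proved; no definitions; standard axioms.  HONEST LABEL: an elementary, untabled glue lemma for step (1b) (Laplace asymptotics of the orbit average, STUB-PLAN-S5U5-STEP1b) of the XL stubs
S5 `stub_landauSecondOrder` / U5 `stub_landauThirdOrder` of critic-PASSed DRAFT lines on the R2ξ″ cruxes ⟨stmt-QuantumFields-24004⟩/⟨24335⟩/⟨24336⟩;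
T-S5.4 proper, S5, U5 and those items remain OPEN; no stub is closed by name, no crux, rung or summit is proved; the Yang–Mills mass gap is NOT
proved by this file.
-/

set_option autoImplicit false

open Finset Matrix
open scoped Kronecker
open Literature.Probability.LatticeModels

namespace Summit.QuantumFields.YangMills.Theorems.AllWindowsColdBoxBoxHighLine

namespace SpectralFloor

/-! ## `BoxKernel.boxLap M univ` is the Dirichlet Laplacian matrix of its point set -/

section BoxBridge

open Summit.QuantumFields.YangMills.Theorems.AllWindowsColdBox.BoxKernel

variable {d M : ℕ}

/-- With all faces Dirichlet the upper-neighbour diagonal coefficient is `1`. -/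
theorem upCoeff_univ (ν : Fin d) (s : Box d M Finset.univ) : upCoeff M Finset.univ ν s = 1 := by
  simp [upCoeff]

/-- With all faces Dirichlet the lower-neighbour diagonal coefficient is `1`. -/
theorem downCoeff_univ (ν : Fin d) (s : Box d M Finset.univ) : downCoeff Finset.univ ν s = 1 := by
  simp [downCoeff]

/-- Unit vectors of `ℤ^d` with equal values have equal indices. -/
theorem single_one_eq_single_one_iff (μ i : Fin d) : (Pi.single μ (1 : ℤ) : Site d) = Pi.single i 1 ↔ μ = i := by
  refine ⟨fun h => ?_, fun h => by rw [h]⟩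
  by_contra hμ
  have := congrFun h μ
  simp [Pi.single_eq_of_ne hμ] at this

/-- `−e_μ ≠ e_i` in `ℤ^d`. -/
theorem neg_single_one_ne_single_one (μ i : Fin d) : -(Pi.single μ (1 : ℤ) : Site d) ≠ Pi.single i 1 := by
  intro h
  have := congrFun h i
  by_cases hμ : i = μ
  · subst hμ; simp at this
  · simp [Pi.single_eq_of_ne hμ] at this

/-- **`boxLap M univ` is, entry by entry under `coords`, the Dirichlet Laplacian matrix of the point set `coords(Box d M univ) ⊆ ℤ^d`.** -/
theorem boxLap_univ_apply_eq_dirichletMatrix (s t : Box d M Finset.univ) :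
    boxLap M Finset.univ s t =
      dirichletMatrix (Finset.univ.image (coords : Box d M Finset.univ → Site d))
        ⟨coords s, Finset.mem_image_of_mem _ (Finset.mem_univ s)⟩
        ⟨coords t, Finset.mem_image_of_mem _ (Finset.mem_univ t)⟩ := by
  classical
  unfold boxLap dirichletMatrix
  rw [Matrix.of_apply]
  simp only [upCoeff_univ, downCoeff_univ, Finset.sum_sub_distrib, Finset.sum_const, Finset.card_univ, Fintype.card_fin,
    Subtype.mk.injEq]
  by_cases hst : t = s
  · subst hst
    have h1 : ∀ ν : Fin d, ¬ (coords t = coords t + Pi.single ν 1) := fun ν h => by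
      have h' := congrFun h ν
      simp only [Pi.add_apply, Pi.single_eq_same] at h'
      omega
    have h2 : ∀ ν : Fin d, ¬ (coords t = coords t - Pi.single ν 1) := fun ν h => by
      have h' := congrFun h ν
      simp only [Pi.sub_apply, Pi.single_eq_same] at h'
      omega
    simp [h1, h2]
    ring
  · have hts : coords t ≠ coords s := fun h => hst (coords_injective h)
    have hst' : coords s ≠ coords t := fun h => hts h.symm
    simp only [hst, if_false, smul_zero, zero_sub, hst']
    by_cases hadj : (zdGraph d).Adj (coords s) (coords t)
    · rw [if_pos hadj]
      obtain ⟨i, hi | hi⟩ := (zdGraph_adj_iff _ _).1 hadj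
      · have hp : ∀ ν : Fin d, (coords t = coords s + Pi.single ν 1) ↔ ν = i := by
          intro ν; rw [hi, add_right_inj, single_one_eq_single_one_iff, eq_comm]
        have hm : ∀ ν : Fin d, ¬ (coords t = coords s - Pi.single ν 1) := by
          intro ν h
          rw [hi, sub_eq_add_neg, add_right_inj] at h
          exact neg_single_one_ne_single_one ν i h.symm
        simp [hp, hm, Finset.sum_ite_eq']
      · have hp : ∀ ν : Fin d, ¬ (coords t = coords s + Pi.single ν 1) := by
          intro ν h
          rw [hi, add_assoc, left_eq_add] at h
          have := congrFun h i
          by_cases hν : ν = i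
          · subst hν; simp at this
          · simp [Pi.single_eq_of_ne (Ne.symm hν)] at this
        have hm : ∀ ν : Fin d, (coords t = coords s - Pi.single ν 1) ↔ ν = i := by
          intro ν
          rw [hi, add_sub_assoc, left_eq_add, sub_eq_zero, single_one_eq_single_one_iff, eq_comm]
        simp [hp, hm, Finset.sum_ite_eq']
    · rw [if_neg hadj]
      have hadj' : ∀ i : Fin d, ¬ (coords t = coords s + Pi.single i 1) ∧ ¬ (coords s = coords t + Pi.single i 1) := by
        intro i
        constructor <;> intro h <;> exact hadj ((zdGraph_adj_iff _ _).2 ⟨i, by tauto⟩)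
      have hm : ∀ ν : Fin d, ¬ (coords t = coords s - Pi.single ν 1) := fun ν h =>
        (hadj' ν).2 (by rw [h, sub_add_cancel])
      have hp : ∀ ν : Fin d, ¬ (coords t = coords s + Pi.single ν 1) := fun ν h => (hadj' ν).1 h
      simp [hm, hp]

/-- The coordinate map as an equivalence onto the point set of the box. -/
theorem coordsEquiv_bijective :
    Function.Bijective (fun s : Box d M Finset.univ =>
      (⟨coords s, Finset.mem_image_of_mem _ (Finset.mem_univ s)⟩ :
        ↥(Finset.univ.image (coords : Box d M Finset.univ → Site d)))) := by
  refine ⟨fun s t h => coords_injective (Subtype.ext_iff.1 h), fun y => ?_⟩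
  obtain ⟨s, -, hs⟩ := Finset.mem_image.1 y.2
  exact ⟨s, Subtype.ext hs⟩

/-- **Poincaré floor of the all-Dirichlet box Laplacian**: `‖f‖² ≤ (M−1)² · fᵀ(boxLap M univ)f` on `Box d M univ` (`d ≥ 1`; coordinates in `[1, M−1]`). -/
theorem boxLap_univ_poincare (hd : 0 < d) (f : Box d M Finset.univ → ℝ) :
    f ⬝ᵥ f ≤ ((M - 1 : ℕ) : ℝ) ^ 2 * (f ⬝ᵥ (boxLap M Finset.univ *ᵥ f)) := by
  classical
  set Λ : Finset (Site d) := Finset.univ.image (coords : Box d M Finset.univ → Site d) with hΛ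
  set e : Box d M Finset.univ ≃ ↥Λ := Equiv.ofBijective _ coordsEquiv_bijective with he
  set g : ↥Λ → ℝ := f ∘ e.symm with hg
  -- the box lies in the slab `1 ≤ x_ν < 1 + (M − 1)` in direction `ν = 0`
  have hslab : ∀ x ∈ Λ, 1 ≤ x ⟨0, hd⟩ ∧ x ⟨0, hd⟩ < 1 + ((M - 1 : ℕ) : ℤ) := by
    intro x hx
    obtain ⟨s, -, rfl⟩ := Finset.mem_image.1 hx
    have h0 : (s.1 ⟨0, hd⟩ : ℕ) ≠ 0 := s.2 _ (Finset.mem_univ _)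
    have hM : (s.1 ⟨0, hd⟩ : ℕ) < M := (s.1 ⟨0, hd⟩).isLt
    simp only [coords]
    constructor
    · exact_mod_cast Nat.one_le_iff_ne_zero.2 h0
    · rw [Nat.cast_sub (by omega : 1 ≤ M)]
      push_cast
      omega
  have hmain := dotProduct_self_le_sq_mul_dotProduct_dirichletMatrix Λ ⟨0, hd⟩ 1 (M - 1) hslab g
  -- `boxLap M univ` is the reindexed Dirichlet Laplacian matrix
  have hsub : boxLap M Finset.univ = (dirichletMatrix Λ).submatrix e e := by
    ext s t
    rw [Matrix.submatrix_apply, boxLap_univ_apply_eq_dirichletMatrix]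
    rfl
  have hfg : ∀ s, f s = g (e s) := fun s => by simp [hg]
  have h1 : f ⬝ᵥ f = g ⬝ᵥ g := by
    rw [dotProduct, dotProduct, ← e.sum_comp (fun y => g y * g y)]
    exact Finset.sum_congr rfl fun s _ => by rw [hfg]
  have h2 : f ⬝ᵥ (boxLap M Finset.univ *ᵥ f) = g ⬝ᵥ (dirichletMatrix Λ *ᵥ g) := by
    rw [hsub, Matrix.submatrix_mulVec_equiv, dotProduct, dotProduct, ← e.sum_comp (fun y => g y * (dirichletMatrix Λ *ᵥ g) y)]
    exact Finset.sum_congr rfl fun s _ => by rw [hfg]; rfl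
  rw [h1, h2]
  exact hmain

/-- **Operator floor of the all-Dirichlet box Laplacian**: `‖f‖² ≤ (M−1)⁴ · ‖boxLap M univ f‖²` (`d ≥ 1`). -/
theorem boxLap_univ_opFloor (hd : 0 < d) (f : Box d M Finset.univ → ℝ) :
    f ⬝ᵥ f ≤ (((M - 1 : ℕ) : ℝ) ^ 2) ^ 2 * ((boxLap M Finset.univ *ᵥ f) ⬝ᵥ (boxLap M Finset.univ *ᵥ f)) :=
  dotProduct_self_le_sq_mul_of_le_mul_dotProduct f _ (sq_nonneg _) (boxLap_univ_poincare hd f)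

/-! ### The cold box: `M = 2H`, the currency `boxLap (2 * H) univ` of the kernel files -/

variable {H : ℕ}

/-- `λ_min(boxLap (2H) univ) ≥ (1/4)/H²`: `(1/4)/H² · ‖f‖² ≤ fᵀ(boxLap (2H) univ)f` for `H ≥ 1` (any dimension `d ≥ 1`). -/
theorem boxLap_twoMul_floor (hd : 0 < d) (hH : 1 ≤ H) (f : Box d (2 * H) Finset.univ → ℝ) :
    1 / 4 / (H : ℝ) ^ 2 * (f ⬝ᵥ f) ≤ f ⬝ᵥ (boxLap (2 * H) Finset.univ *ᵥ f) := by
  have h := boxLap_univ_poincare hd f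
  have hH' : (1 : ℝ) ≤ H := by exact_mod_cast hH
  have hp : ((2 * H - 1 : ℕ) : ℝ) = 2 * H - 1 := by
    rw [Nat.cast_sub (by omega : 1 ≤ 2 * H)]; push_cast; ring
  rw [hp] at h
  have hvv : 0 ≤ f ⬝ᵥ f := Finset.sum_nonneg fun i _ => mul_self_nonneg _
  have hQ : 0 ≤ f ⬝ᵥ (boxLap (2 * H) Finset.univ *ᵥ f) := by
    have hpos : 0 < (2 * (H : ℝ) - 1) ^ 2 := by nlinarith
    by_contra hneg
    push Not at hneg
    have := mul_neg_of_pos_of_neg hpos hneg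
    linarith
  have hH2 : 0 < (H : ℝ) ^ 2 := by positivity
  rw [div_mul_eq_mul_div, div_le_iff₀ hH2]
  nlinarith

/-- **`λ_min((boxLap (2H) univ)ᵀ(boxLap (2H) univ)) ≥ (1/16)/H⁴`**: `(1/16)/H⁴ · ‖f‖² ≤ ‖boxLap (2H) univ f‖²` for `H ≥ 1`. -/
theorem boxLap_twoMul_opFloor (hd : 0 < d) (hH : 1 ≤ H) (f : Box d (2 * H) Finset.univ → ℝ) :
    1 / 16 / (H : ℝ) ^ 4 * (f ⬝ᵥ f) ≤ (boxLap (2 * H) Finset.univ *ᵥ f) ⬝ᵥ (boxLap (2 * H) Finset.univ *ᵥ f) := by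
  have h := boxLap_univ_opFloor hd f
  have hH' : (1 : ℝ) ≤ H := by exact_mod_cast hH
  have hp : ((2 * H - 1 : ℕ) : ℝ) = 2 * H - 1 := by
    rw [Nat.cast_sub (by omega : 1 ≤ 2 * H)]; push_cast; ring
  rw [hp] at h
  have hvv : 0 ≤ f ⬝ᵥ f := Finset.sum_nonneg fun i _ => mul_self_nonneg _
  have hQ : 0 ≤ (boxLap (2 * H) Finset.univ *ᵥ f) ⬝ᵥ (boxLap (2 * H) Finset.univ *ᵥ f) :=
    Finset.sum_nonneg fun i _ => mul_self_nonneg _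
  have hH4 : 0 < (H : ℝ) ^ 4 := by positivity
  rw [div_mul_eq_mul_div, div_le_iff₀ hH4]
  have h16 : ((2 * (H : ℝ) - 1) ^ 2) ^ 2 ≤ 16 * (H : ℝ) ^ 4 := by nlinarith [sq_nonneg (2 * (H : ℝ) - 1)]
  nlinarith

/-- `boxLap (2H) univ` is invertible (`d, H ≥ 1`; the tree's `isUnit_det_boxLap`). -/
theorem isUnit_det_boxLap_twoMul (hd : 0 < d) (hH : 1 ≤ H) : IsUnit (boxLap (d := d) (2 * H) Finset.univ).det := by
  haveI : NeZero (2 * H) := ⟨by omega⟩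
  haveI : Nonempty (Fin d) := ⟨⟨0, hd⟩⟩
  exact isUnit_det_boxLap Finset.univ_nonempty

/-- **Inverse operator bound**: `‖(boxLap (2H) univ)⁻¹ w‖² ≤ 16H⁴ · ‖w‖²` (`‖boxLap⁻¹‖₂ ≤ 4H²`). -/
theorem boxLap_twoMul_inv_opBound (hd : 0 < d) (hH : 1 ≤ H) (w : Box d (2 * H) Finset.univ → ℝ) :
    ((boxLap (2 * H) Finset.univ)⁻¹ *ᵥ w) ⬝ᵥ ((boxLap (2 * H) Finset.univ)⁻¹ *ᵥ w) ≤ 16 * (H : ℝ) ^ 4 * (w ⬝ᵥ w) := by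
  have h := inv_opBound_of_opFloor _ (isUnit_det_boxLap_twoMul hd hH) (boxLap_twoMul_opFloor hd hH) w
  have hH4 : 0 < (H : ℝ) ^ 4 := by
    have : (1 : ℝ) ≤ H := by exact_mod_cast hH
    positivity
  rw [div_mul_eq_mul_div, div_le_iff₀ hH4] at h
  linarith

/-- **Green-form bound**: `wᵀ(boxLap (2H) univ)⁻¹w ≤ 4H² · ‖w‖²`. -/
theorem boxLap_twoMul_inv_form_le (hd : 0 < d) (hH : 1 ≤ H) (w : Box d (2 * H) Finset.univ → ℝ) :
    w ⬝ᵥ ((boxLap (2 * H) Finset.univ)⁻¹ *ᵥ w) ≤ 4 * (H : ℝ) ^ 2 * (w ⬝ᵥ w) := by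
  refine dotProduct_inv_mulVec_le_of_floor _ (isUnit_det_boxLap_twoMul hd hH) (by positivity) (fun v => ?_) w
  have h := boxLap_twoMul_floor hd hH v
  have hH2 : 0 < (H : ℝ) ^ 2 := by
    have : (1 : ℝ) ≤ H := by exact_mod_cast hH
    positivity
  rw [div_mul_eq_mul_div, div_le_iff₀ hH2] at h
  linarith

/-! ### The colour-diagonal operator `boxLap (2H) univ ⊗ₖ 1` and its perturbations (the shape of `fpOperator H U` in (4c)) -/

variable {o : Type*} [Fintype o] [DecidableEq o]

/-- Operator floor of `boxLap (2H) univ ⊗ₖ 1_o`: `(1/16)/H⁴ · ‖w‖² ≤ ‖(boxLap (2H) univ ⊗ₖ 1) w‖²`. -/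
theorem boxLap_twoMul_kronecker_opFloor (hd : 0 < d) (hH : 1 ≤ H) (w : Box d (2 * H) Finset.univ × o → ℝ) :
    1 / 16 / (H : ℝ) ^ 4 * (w ⬝ᵥ w) ≤
      ((boxLap (2 * H) Finset.univ ⊗ₖ (1 : Matrix o o ℝ)) *ᵥ w) ⬝ᵥ ((boxLap (2 * H) Finset.univ ⊗ₖ (1 : Matrix o o ℝ)) *ᵥ w) :=
  opFloor_kronecker_one _ (boxLap_twoMul_opFloor hd hH) w

/-- **The (4g) hypothesis for a perturbed colour-diagonal box Laplacian.**  If `E` has row and column ℓ¹ sums `≤ r` with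
`0 ≤ r ≤ (1/4)/H²`, then `((1/4)/H² − r)² · ‖w‖² ≤ ‖(boxLap (2H) univ ⊗ₖ 1 + E) w‖²` for all `w`. -/
theorem boxLap_twoMul_kronecker_add_opFloor (hd : 0 < d) (hH : 1 ≤ H)
    (E : Matrix (Box d (2 * H) Finset.univ × o) (Box d (2 * H) Finset.univ × o) ℝ) {r : ℝ} (hr : 0 ≤ r)
    (hrH : r ≤ 1 / 4 / (H : ℝ) ^ 2) (hrow : ∀ i, ∑ j, |E i j| ≤ r) (hcol : ∀ j, ∑ i, |E i j| ≤ r)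
    (w : Box d (2 * H) Finset.univ × o → ℝ) :
    (1 / 4 / (H : ℝ) ^ 2 - r) ^ 2 * (w ⬝ᵥ w) ≤
      ((boxLap (2 * H) Finset.univ ⊗ₖ (1 : Matrix o o ℝ) + E) *ᵥ w) ⬝ᵥ
        ((boxLap (2 * H) Finset.univ ⊗ₖ (1 : Matrix o o ℝ) + E) *ᵥ w) := by
  refine opFloor_add _ E hr hrH (fun v => ?_) (mulVec_dotProduct_self_le_of_row_col E hr hrow hcol) w
  have h := boxLap_twoMul_kronecker_opFloor (o := o) hd hH v
  have hH' : (H : ℝ) ≠ 0 := by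
    have : (1 : ℝ) ≤ H := by exact_mod_cast hH
    positivity
  have he : (1 / 4 / (H : ℝ) ^ 2) ^ 2 = 1 / 16 / (H : ℝ) ^ 4 := by
    field_simp; ring
  rw [he]
  exact h

/-- … hence such a perturbation is invertible as soon as `r < (1/4)/H²`, with `‖(boxLap ⊗ 1 + E)⁻¹ u‖² ≤ ((1/4)/H² − r)⁻² ‖u‖²`. -/
theorem boxLap_twoMul_kronecker_add_inv (hd : 0 < d) (hH : 1 ≤ H)
    (E : Matrix (Box d (2 * H) Finset.univ × o) (Box d (2 * H) Finset.univ × o) ℝ) {r : ℝ} (hr : 0 ≤ r)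
    (hrH : r < 1 / 4 / (H : ℝ) ^ 2) (hrow : ∀ i, ∑ j, |E i j| ≤ r) (hcol : ∀ j, ∑ i, |E i j| ≤ r) :
    IsUnit (boxLap (2 * H) Finset.univ ⊗ₖ (1 : Matrix o o ℝ) + E).det ∧
      ∀ u : Box d (2 * H) Finset.univ × o → ℝ,
        (1 / 4 / (H : ℝ) ^ 2 - r) ^ 2 *
            (((boxLap (2 * H) Finset.univ ⊗ₖ (1 : Matrix o o ℝ) + E)⁻¹ *ᵥ u) ⬝ᵥ
              ((boxLap (2 * H) Finset.univ ⊗ₖ (1 : Matrix o o ℝ) + E)⁻¹ *ᵥ u)) ≤ u ⬝ᵥ u := by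
  have hfl := boxLap_twoMul_kronecker_add_opFloor hd hH E hr hrH.le hrow hcol
  have hc : 0 < (1 / 4 / (H : ℝ) ^ 2 - r) ^ 2 := by
    have : 0 < 1 / 4 / (H : ℝ) ^ 2 - r := sub_pos.2 hrH
    positivity
  have hU := isUnit_det_of_opFloor _ hc hfl
  exact ⟨hU, inv_opBound_of_opFloor _ hU hfl⟩


/-! ### Reindexing along an equivalence (the (4g) brick `GaussianTailBound` is stated on `Fin n`) -/

omit [Fintype o] [DecidableEq o] in
/-- An operator floor passes to the reindexed matrix `B.submatrix e e` (`e : κ ≃ ι`; `= reindex e.symm e.symm B`). -/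
theorem opFloor_submatrix_equiv {ι κ : Type*} [Fintype ι] [Fintype κ] (B : Matrix ι ι ℝ) (e : κ ≃ ι) {c : ℝ}
    (h : ∀ v : ι → ℝ, c * (v ⬝ᵥ v) ≤ (B *ᵥ v) ⬝ᵥ (B *ᵥ v)) (w : κ → ℝ) :
    c * (w ⬝ᵥ w) ≤ (B.submatrix e e *ᵥ w) ⬝ᵥ (B.submatrix e e *ᵥ w) := by
  have hw : w ⬝ᵥ w = (w ∘ e.symm) ⬝ᵥ (w ∘ e.symm) := by
    rw [dotProduct, dotProduct, ← e.sum_comp (fun y => (w ∘ e.symm) y * (w ∘ e.symm) y)]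
    simp
  have hB : (B.submatrix e e *ᵥ w) ⬝ᵥ (B.submatrix e e *ᵥ w) =
      (B *ᵥ (w ∘ e.symm)) ⬝ᵥ (B *ᵥ (w ∘ e.symm)) := by
    rw [Matrix.submatrix_mulVec_equiv, dotProduct, dotProduct,
      ← e.sum_comp (fun y => (B *ᵥ (w ∘ e.symm)) y * (B *ᵥ (w ∘ e.symm)) y)]
    rfl
  rw [hw, hB]
  exact h _

/-! ### Perturbed inverses, pointwise: `‖(A + E)⁻¹w‖ ≤ ‖A⁻¹w‖ / (1 − ‖A⁻¹‖‖E‖)` (for tr((MᵀM)⁻¹) = ‖M⁻¹‖_F² in the 4i merge) -/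

omit [Fintype o] [DecidableEq o] in
/-- **Pointwise perturbation of the inverse**: if `‖A⁻¹w‖² ≤ a²‖w‖²`, `‖Ev‖² ≤ r²‖v‖²` and `a·r < 1`, then `A + E` is invertible and
`(1 − a r)²·‖(A + E)⁻¹w‖² ≤ ‖A⁻¹w‖²` for EVERY `w` (factor `A + E = A(1 + A⁻¹E)` and apply the floor of `1 + A⁻¹E`).  Summed over `w = e_t` this bounds the
Frobenius norm `‖(A + E)⁻¹‖_F ≤ ‖A⁻¹‖_F/(1 − a r)`; with `w` free it also bounds `‖(A + E)⁻¹‖₂ ≤ a/(1 − a r)`. -/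
theorem inv_add_pointwise_le {ι : Type*} [Fintype ι] [DecidableEq ι] (A E : Matrix ι ι ℝ) (hA : IsUnit A.det) {a r : ℝ}
    (ha : 0 ≤ a) (hr : 0 ≤ r) (har : a * r < 1)
    (hAinv : ∀ w : ι → ℝ, (A⁻¹ *ᵥ w) ⬝ᵥ (A⁻¹ *ᵥ w) ≤ a ^ 2 * (w ⬝ᵥ w))
    (hE : ∀ v : ι → ℝ, (E *ᵥ v) ⬝ᵥ (E *ᵥ v) ≤ r ^ 2 * (v ⬝ᵥ v)) :
    IsUnit (A + E).det ∧
      ∀ w : ι → ℝ, (1 - a * r) ^ 2 * (((A + E)⁻¹ *ᵥ w) ⬝ᵥ ((A + E)⁻¹ *ᵥ w)) ≤ (A⁻¹ *ᵥ w) ⬝ᵥ (A⁻¹ *ᵥ w) := by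
  have hX : ∀ v : ι → ℝ, ((A⁻¹ * E) *ᵥ v) ⬝ᵥ ((A⁻¹ * E) *ᵥ v) ≤ (a * r) ^ 2 * (v ⬝ᵥ v) := by
    intro v
    rw [← Matrix.mulVec_mulVec]
    calc (A⁻¹ *ᵥ (E *ᵥ v)) ⬝ᵥ (A⁻¹ *ᵥ (E *ᵥ v)) ≤ a ^ 2 * ((E *ᵥ v) ⬝ᵥ (E *ᵥ v)) := hAinv _
      _ ≤ a ^ 2 * (r ^ 2 * (v ⬝ᵥ v)) := mul_le_mul_of_nonneg_left (hE v) (sq_nonneg _)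
      _ = (a * r) ^ 2 * (v ⬝ᵥ v) := by ring
  have hfloor : ∀ v : ι → ℝ, (1 - a * r) ^ 2 * (v ⬝ᵥ v) ≤ ((1 + A⁻¹ * E) *ᵥ v) ⬝ᵥ ((1 + A⁻¹ * E) *ᵥ v) :=
    opFloor_add 1 (A⁻¹ * E) (mul_nonneg ha hr) har.le (fun v => by rw [Matrix.one_mulVec, one_pow, one_mul]) hX
  have hc : 0 < (1 - a * r) ^ 2 := by
    have : 0 < 1 - a * r := sub_pos.2 har
    positivity
  have h1X : IsUnit (1 + A⁻¹ * E).det := isUnit_det_of_opFloor _ hc hfloor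
  have hfac : A + E = A * (1 + A⁻¹ * E) := by
    rw [Matrix.mul_add, Matrix.mul_one, ← Matrix.mul_assoc, Matrix.mul_nonsing_inv A hA, Matrix.one_mul]
  have hAE : IsUnit (A + E).det := by
    rw [hfac, Matrix.det_mul]
    exact hA.mul h1X
  refine ⟨hAE, fun w => ?_⟩
  have hv : (1 + A⁻¹ * E) *ᵥ ((A + E)⁻¹ *ᵥ w) = A⁻¹ *ᵥ w := by
    have h1 : A⁻¹ * (A + E) = 1 + A⁻¹ * E := by rw [Matrix.mul_add, Matrix.nonsing_inv_mul A hA]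
    rw [← h1, ← Matrix.mulVec_mulVec, Matrix.mulVec_mulVec w (A + E), Matrix.mul_nonsing_inv _ hAE, Matrix.one_mulVec]
  have := hfloor ((A + E)⁻¹ *ᵥ w)
  rwa [hv] at this

omit [Fintype o] [DecidableEq o] in
/-- The squared Frobenius norm as the sum of the squared column norms: `Σ_{s,t} B_{st}² = Σ_t ‖B e_t‖²`. -/
theorem sum_sq_eq_sum_mulVec_single {ι : Type*} [Fintype ι] [DecidableEq ι] (B : Matrix ι ι ℝ) :
    ∑ s, ∑ t, B s t ^ 2 = ∑ t, (B *ᵥ Pi.single t 1) ⬝ᵥ (B *ᵥ Pi.single t 1) := by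
  rw [Finset.sum_comm]
  refine Finset.sum_congr rfl fun t _ => ?_
  rw [dotProduct]
  refine Finset.sum_congr rfl fun s _ => ?_
  simp [sq]

/-- **The cold box, perturbed, pointwise**: for `E` with row and column ℓ¹ sums `≤ r` and `4H²·r < 1`, `boxLap (2H) univ ⊗ₖ 1 + E` is invertible and
`(1 − 4H² r)²·‖(boxLap (2H) univ ⊗ₖ 1 + E)⁻¹ w‖² ≤ ‖(boxLap (2H) univ ⊗ₖ 1)⁻¹ w‖²` for every `w` (so its Frobenius norm, hence `tr((MᵀM)⁻¹)` of the 4i merge,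
is at most `(1 − 4H²r)⁻²` times the unperturbed one, which factorises over the colours into `|o|·‖(boxLap (2H) univ)⁻¹‖_F²` = the (4i-a) row sums). -/
theorem boxLap_twoMul_kronecker_add_inv_pointwise (hd : 0 < d) (hH : 1 ≤ H)
    (E : Matrix (Box d (2 * H) Finset.univ × o) (Box d (2 * H) Finset.univ × o) ℝ) {r : ℝ} (hr : 0 ≤ r)
    (hrH : 4 * (H : ℝ) ^ 2 * r < 1) (hrow : ∀ i, ∑ j, |E i j| ≤ r) (hcol : ∀ j, ∑ i, |E i j| ≤ r) :
    IsUnit (boxLap (2 * H) Finset.univ ⊗ₖ (1 : Matrix o o ℝ) + E).det ∧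
      ∀ w : Box d (2 * H) Finset.univ × o → ℝ,
        (1 - 4 * (H : ℝ) ^ 2 * r) ^ 2 *
            (((boxLap (2 * H) Finset.univ ⊗ₖ (1 : Matrix o o ℝ) + E)⁻¹ *ᵥ w) ⬝ᵥ
              ((boxLap (2 * H) Finset.univ ⊗ₖ (1 : Matrix o o ℝ) + E)⁻¹ *ᵥ w)) ≤
          ((boxLap (2 * H) Finset.univ ⊗ₖ (1 : Matrix o o ℝ))⁻¹ *ᵥ w) ⬝ᵥ ((boxLap (2 * H) Finset.univ ⊗ₖ (1 : Matrix o o ℝ))⁻¹ *ᵥ w) := by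
  have hfl := boxLap_twoMul_kronecker_opFloor (o := o) hd hH
  have hH' : (1 : ℝ) ≤ H := by exact_mod_cast hH
  have hc : 0 < 1 / 16 / (H : ℝ) ^ 4 := by positivity
  have hU := isUnit_det_of_opFloor _ hc hfl
  have hinv : ∀ w : Box d (2 * H) Finset.univ × o → ℝ,
      (((boxLap (2 * H) Finset.univ ⊗ₖ (1 : Matrix o o ℝ))⁻¹ *ᵥ w) ⬝ᵥ ((boxLap (2 * H) Finset.univ ⊗ₖ (1 : Matrix o o ℝ))⁻¹ *ᵥ w)) ≤
        (4 * (H : ℝ) ^ 2) ^ 2 * (w ⬝ᵥ w) := by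
    intro w
    have h := inv_opBound_of_opFloor _ hU hfl w
    have hH4 : 0 < (H : ℝ) ^ 4 := by positivity
    rw [div_mul_eq_mul_div, div_le_iff₀ hH4] at h
    nlinarith
  have hm := mulVec_dotProduct_self_le_of_row_col E hr hrow hcol
  exact inv_add_pointwise_le _ E hU (by positivity) hr hrH hinv hm

end BoxBridge

end SpectralFloor

end Summit.QuantumFields.YangMills.Theorems.AllWindowsColdBoxBoxHighLine
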